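import Mathlib.Tactic
import HarnessLib
import HarnessLib.Audit.Tags
import Summits.CriticalPhenomena.PercolationContinuityZ3.Theorems.PercNearOneGluingNoHeavyLowerTailSahiAntichainTwoLowY
import Summits.CriticalPhenomena.PercolationContinuityZ3.Theorems.PercNearOneGluingNoHeavyLowerTailSahiAntichainThreeCoFour
import Summits.CriticalPhenomena.PercolationContinuityZ3.Theorems.PercNearOneGluingNoHeavyLowerTailSahiAntichainTwoFour
import Summits.CriticalPhenomena.PercolationContinuityZ3.Theorems.PercNearOneGluingNoHeavyLowerTailSahiAntichainTwoLemmas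
import Summits.CriticalPhenomena.PercolationContinuityZ3.Theorems.PercNearOneGluingNoHeavyLowerTailSahiAntichainTwoThreeS
import Summits.CriticalPhenomena.PercolationContinuityZ3.Theorems.PercNearOneGluingNoHeavyLowerTailSahiAntichainTwoThreeC
import Summits.CriticalPhenomena.PercolationContinuityZ3.Theorems.PercNearOneGluingNoHeavyLowerTailSahiAntichainTwoThreeF

/-!
# Antichains, meets plus joins: two members above a three-member (co)sunflower — the extreme meet counts

Support file (seat `prim-masterthm-p1`, gen 37; `--supports stmt-CriticalPhenomena-4575`).  No `sorry`, no new definitions, standard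
axioms.  Memo `run/shared/lean/prim/prim-masterthm/FROM-prim-masterthm-p1-g37-LINEAR-REDUCTION.md` §9.1 (the H23 decomposition).

SETTING: L3 (`f(5) ≥ 10`) is reduced to H23 (`…TwoFour`): at a point with two members `a, a'` above and three below,
`f(below) + newLabels ≥ 8`.  By `…TwoLowY` one may assume `newJoins ≥ 2`; the complete atom-pattern census (memo §9.1) shows that what
remains is «`newJoins = 2 ⟹ newMeets ≥ 2`» together with the two extreme statements proved here.

NEW HERE ([this work], gen 37).
* `six_le_card_newJoins_of_two_sunflower_three` — **two above, a three-member SUNFLOWER below, and NO new meet ⟹ six new joins**: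
  every cross meet is then the core `K`, so `b ↦ g ∪ b` is injective on each row (lattice cancellation), the two rows are disjoint
  (a point of `a \\ a'` lies in every `a ∪ b` but in no `a' ∪ b'`, as it would lie in `a ∩ b' = K ⊆ a'`), and no cross join is `a ∪ a'`.
* `newMeets_nonempty_of_cothree` — **any member above a three-member CO-SUNFLOWER below has a new cross meet** (so `newMeets ≥ 1` at such
  points): if the three cross meets `g ∩ bⱼ` were all meets of the co-sunflower, two of them using different pairs would put
  `bᵢ ∩ (bⱼ ∪ bₖ) = bᵢ` inside `g`, while all three using the same pair `{k, l}` would put the co-petal `U \\ b_m ⊆ b_k ∩ b_l = g ∩ b_m` inside `b_m`.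
* Packaging: `h23_of` — **H23 follows from three residual statements, one per shape of the three-side**: (S) sunflower below and at most one
  new meet ⟹ ≥ 5 new joins; (C) co-sunflower below and at most one new meet ⟹ ≥ 3 new joins; (F) neither, five labels of its own, and no new meet ⟹ ≥ 3 new joins
  (complete atom census, memo §9.1: all true for every ground set; paper proofs memo §8.3/§8.5); hence `ten_le_of_SCF : S → C → F → L3` and
  **`two_mul_card_le_of_SCF_L4 : S → C → F → L4 → V5`**.  [Cases: `newJoins ≤ 1` by `…TwoLowY`; else two new meets suffice ((S),(C) give them
  by contraposition), and for a five-label triple one new meet suffices ((F)).]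
* **With (S) `…TwoThreeS`, (C) `…TwoThreeC`, (F) `…TwoThreeF` all proved this gen: `eight_le_of_two_three` (H23) and
  `ten_le_of_card_eq_five` — L3, EVERY FIVE-MEMBER ANTICHAIN HAS AT LEAST TEN LABELS — are unconditional**, and
  **`two_mul_card_le_of_L4 : L4 → V5`** (with `antichainSmallSide_of_L4`, `antichainMidRange_of_L4`, the linear form and V1):
  the conjecture V5 now rests on the single finite statement L4 about six-member sides.
HONEST FRAMING: L4 and V5 remain OPEN (L4 true in all data: exhaustive `2^6`, annealing n ≤ 9; the six-member sides with ≤ 11 labels are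
the `C([4],2)` blow-ups, which create ≥ 4 new labels). [this work]
-/

namespace Summit.CriticalPhenomena.PercolationContinuityZ3.Theorems.SahiColouredDaykin

open Finset

variable {α : Type*} [DecidableEq α]

section TwoThree

variable {P : Finset (Finset α)} {r : α}

/-- **Two above, sunflower below, no new meet ⟹ six new joins.** [this work] -/
theorem six_le_card_newJoins_of_two_sunflower_three {K : Finset α} (hanti : IsAntichain (· ⊆ ·) (P : Set (Finset α)))
    (h2 : #(above P r) = 2) (h3 : #(below P r) = 3)
    (hK : ∀ b ∈ below P r, ∀ b' ∈ below P r, b ≠ b' → b ∩ b' = K) (h0 : newMeets P r = ∅) :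
    6 ≤ #(newJoins P r) := by
  obtain ⟨a, a', hne, hA⟩ := card_eq_two.1 h2
  have ha : a ∈ above P r := by rw [hA]; simp
  have ha' : a' ∈ above P r := by rw [hA]; simp
  obtain ⟨haP, hra⟩ := mem_above_iff.1 ha
  obtain ⟨ha'P, hra'⟩ := mem_above_iff.1 ha'
  have hJ : joins (above P r) = {a ∪ a'} := by rw [hA, joins_pair hne]
  -- every cross meet is `K`
  have hL : ∀ Z ∈ meets (below P r), Z = K := by
    intro Z hZ
    obtain ⟨d, hd, d', hd', hdd', rfl⟩ := mem_meets_iff.1 hZ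
    exact hK d hd d' hd' hdd'
  have crossK : ∀ {g b : Finset α}, g ∈ above P r → b ∈ below P r → g ∩ b = K := by
    intro g b hg hb
    have hmem : g ∩ b ∈ meets (below P r) := by
      by_contra hnot
      have : g ∩ b ∈ newMeets P r := (inter_mem_newMeets_iff hg hb).2 hnot
      rw [h0] at this; exact absurd this (notMem_empty _)
    exact hL _ hmem
  -- points separating `a` and `a'`
  have naa' : ¬ a ⊆ a' := hanti (mem_coe.2 haP) (mem_coe.2 ha'P) hne
  have na'a : ¬ a' ⊆ a := hanti (mem_coe.2 ha'P) (mem_coe.2 haP) hne.symm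
  obtain ⟨s, hsa, hsa'⟩ := not_subset.1 naa'
  obtain ⟨t, hta', hta⟩ := not_subset.1 na'a
  -- a generic row: the three cross joins through `g` are new and pairwise distinct
  have row : ∀ {g g' : Finset α} {z : α}, g ∈ above P r → g' ∈ above P r → g ≠ g' → z ∈ g' → z ∉ g →
      (∀ b ∈ below P r, g ∪ b ∈ newJoins P r) ∧ Set.InjOn (fun b => g ∪ b) (below P r : Set (Finset α)) := by
    intro g g' z hg hg' hgg' hzg' hzg
    refine ⟨?_, ?_⟩
    · intro b hb
      rw [union_mem_newJoins_iff hg hb, hJ, mem_singleton]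
      intro hu
      -- `g' ⊆ g ∪ b` puts `z` in `b`, hence in `g' ∩ b = K ⊆ g`
      have hg'u : g' ⊆ a ∪ a' := by
        rw [hA, mem_insert, mem_singleton] at hg'
        rcases hg' with rfl | rfl
        · exact subset_union_left
        · exact subset_union_right
      have hzb : z ∈ b := by
        have : z ∈ g ∪ b := by rw [hu]; exact hg'u hzg'
        rcases mem_union.1 this with h | h
        · exact absurd h hzg
        · exact h
      have hzK : z ∈ K := by rw [← crossK hg' hb]; exact mem_inter.2 ⟨hzg', hzb⟩
      have : z ∈ g := by
        have hKg : K ⊆ g := by rw [← crossK hg hb]; exact inter_subset_left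
        exact hKg hzK
      exact hzg this
    · intro b hb b' hb' h
      exact eq_of_inter_eq_of_union_eq (by rw [crossK hg (mem_coe.1 hb), crossK hg (mem_coe.1 hb')]) h
  obtain ⟨newA, injA⟩ := row ha ha' hne hta' hta
  obtain ⟨newA', injA'⟩ := row ha' ha hne.symm hsa hsa'
  -- the rows are disjoint: `s ∈ a ∪ b`, and `s ∈ a' ∪ b'` would force `s ∈ a ∩ b' = K ⊆ a'`
  have hdisj : Disjoint ((below P r).image fun b => a ∪ b) ((below P r).image fun b => a' ∪ b) := by
    rw [disjoint_left]
    intro W hW hW'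
    obtain ⟨b, hb, rfl⟩ := mem_image.1 hW
    obtain ⟨b', hb', heq'⟩ := mem_image.1 hW'
    have : s ∈ a' ∪ b' := by rw [heq']; exact mem_union_left _ hsa
    rcases mem_union.1 this with h | h
    · exact hsa' h
    · have hsK : s ∈ K := by rw [← crossK ha hb']; exact mem_inter.2 ⟨hsa, h⟩
      have hKa' : K ⊆ a' := by rw [← crossK ha' hb']; exact inter_subset_left
      exact hsa' (hKa' hsK)
  have hsub : (below P r).image (fun b => a ∪ b) ∪ (below P r).image (fun b => a' ∪ b) ⊆ newJoins P r := by
    intro W hW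
    rcases mem_union.1 hW with hW | hW
    · obtain ⟨b, hb, rfl⟩ := mem_image.1 hW; exact newA b hb
    · obtain ⟨b, hb, rfl⟩ := mem_image.1 hW; exact newA' b hb
  have h1 : #((below P r).image fun b => a ∪ b) = #(below P r) := card_image_of_injOn injA
  have h1' : #((below P r).image fun b => a' ∪ b) = #(below P r) := card_image_of_injOn injA'
  have := card_le_card hsub
  rw [card_union_of_disjoint hdisj, h1, h1'] at this
  omega

/-- **A member above a three-member co-sunflower has a new cross meet.** [this work] -/
theorem exists_newMeet_of_cothree {U : Finset α} (hanti : IsAntichain (· ⊆ ·) (P : Set (Finset α)))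
    (h3 : #(below P r) = 3) (hU : ∀ b ∈ below P r, ∀ b' ∈ below P r, b ≠ b' → b ∪ b' = U)
    {g : Finset α} (hg : g ∈ above P r) : ∃ b ∈ below P r, g ∩ b ∈ newMeets P r := by
  have hB2 : 1 < #(below P r) := by omega
  obtain ⟨hgP, hrg⟩ := mem_above_iff.1 hg
  obtain ⟨b₁, b₂, b₃, h12, h13, h23, hB⟩ := card_eq_three.1 h3
  have mem : ∀ b ∈ below P r, b = b₁ ∨ b = b₂ ∨ b = b₃ := by
    intro b hb; rw [hB, mem_insert, mem_insert, mem_singleton] at hb; exact hb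
  have hb₁ : b₁ ∈ below P r := by rw [hB]; simp
  have hb₂ : b₂ ∈ below P r := by rw [hB]; simp
  have hb₃ : b₃ ∈ below P r := by rw [hB]; simp
  by_contra hnone
  push Not at hnone
  -- every cross meet through `g` is a meet of two members below
  have old : ∀ {b : Finset α}, b ∈ below P r → ∃ d ∈ below P r, ∃ d' ∈ below P r, d ≠ d' ∧ g ∩ b = d ∩ d' := by
    intro b hb
    have h := hnone b hb
    rw [inter_mem_newMeets_iff hg hb, not_not] at h
    obtain ⟨d, hd, d', hd', hdd', heq⟩ := mem_meets_iff.1 h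
    exact ⟨d, hd, d', hd', hdd', heq⟩
  -- (A) an old cross meet `g ∩ b = d ∩ d'` uses a pair containing `b`: otherwise the co-petal `U \ b ⊆ d ∩ d' ⊆ b`
  have pair_mem : ∀ {b d d' : Finset α}, b ∈ below P r → d ∈ below P r → d' ∈ below P r → d ≠ d' → g ∩ b = d ∩ d' →
      b = d ∨ b = d' := by
    intro b d d' hb hd hd' hdd' heq
    by_contra hne
    push Not at hne
    obtain ⟨x, hx⟩ := sdiff_nonempty_of_below_cosunflower hanti hU hB2 hb
    have hxd : x ∈ d := sdiff_subset_of_below_cosunflower hU hb hd hne.1 hx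
    have hxd' : x ∈ d' := sdiff_subset_of_below_cosunflower hU hb hd' hne.2 hx
    have : x ∈ g ∩ b := by rw [heq]; exact mem_inter.2 ⟨hxd, hxd'⟩
    exact (mem_sdiff.1 hx).2 (mem_inter.1 this).2
  -- (B) so `g ∩ b = b ∩ e` for some other member `e`, whence `b ∩ e ⊆ g`
  have step : ∀ {b : Finset α}, b ∈ below P r → ∃ e ∈ below P r, e ≠ b ∧ b ∩ e ⊆ g := by
    intro b hb
    obtain ⟨d, hd, d', hd', hdd', heq⟩ := old hb
    rcases pair_mem hb hd hd' hdd' heq with rfl | rfl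
    · exact ⟨d', hd', hdd'.symm, by rw [← heq]; exact inter_subset_left⟩
    · exact ⟨d, hd, hdd', by rw [inter_comm, ← heq]; exact inter_subset_left⟩
  -- (C) two different pairs through a common member put that member inside `g`
  have absorb : ∀ {b e e' : Finset α}, b ∈ below P r → e ∈ below P r → e' ∈ below P r → e ≠ b → e' ≠ b → e ≠ e' →
      b ∩ e ⊆ g → b ∩ e' ⊆ g → False := by
    intro b e e' hb he he' heb he'b hee' h1 h2
    have hbg : b ⊆ g := by
      intro x hxb
      by_cases hxe : x ∈ e
      · exact h1 (mem_inter.2 ⟨hxb, hxe⟩)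
      · -- `x ∈ U \ e ⊆ e'`
        have hxU : x ∈ U := subset_of_below_cosunflower hU hB2 hb hxb
        have hxe' : x ∈ e' := sdiff_subset_of_below_cosunflower hU he he' hee' (mem_sdiff.2 ⟨hxU, hxe⟩)
        exact h2 (mem_inter.2 ⟨hxb, hxe'⟩)
    have hne : b ≠ g := by rintro rfl; exact (mem_below_iff.1 hb).2 hrg
    exact hanti (mem_coe.2 (below_subset P r hb)) (mem_coe.2 hgP) hne hbg
  -- apply (B) to the three members and chase the pairs
  obtain ⟨e₁, he₁, hne₁, hs₁⟩ := step hb₁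
  obtain ⟨e₂, he₂, hne₂, hs₂⟩ := step hb₂
  obtain ⟨e₃, he₃, hne₃, hs₃⟩ := step hb₃
  rcases mem e₁ he₁ with rfl | rfl | rfl
  · exact hne₁ rfl
  · -- pair {1,2} through b₁; now b₂'s pair
    rcases mem e₂ he₂ with rfl | rfl | rfl
    · -- pairs {1,2} (via b₁) and {2,1}: same pair; then b₃'s pair is {3,1} or {3,2}, a different pair sharing a member
      rcases mem e₃ he₃ with rfl | rfl | rfl
      · exact absorb hb₁ hb₂ hb₃ h12.symm h13.symm h23 hs₁ (by rw [inter_comm]; exact hs₃)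
      · exact absorb hb₂ hb₁ hb₃ h12 h23.symm h13 hs₂ (by rw [inter_comm]; exact hs₃)
      · exact hne₃ rfl
    · exact hne₂ rfl
    · -- pairs {1,2} and {2,3}: both through b₂
      exact absorb hb₂ hb₁ hb₃ h12 h23.symm h13 (by rw [inter_comm]; exact hs₁) hs₂
  · -- pair {1,3} through b₁
    rcases mem e₃ he₃ with rfl | rfl | rfl
    · -- pairs {1,3} and {3,1}: same; b₂'s pair is {2,1} or {2,3}
      rcases mem e₂ he₂ with rfl | rfl | rfl
      · exact absorb hb₁ hb₃ hb₂ h13.symm h12.symm h23.symm hs₁ (by rw [inter_comm]; exact hs₂)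
      · exact hne₂ rfl
      · exact absorb hb₃ hb₁ hb₂ h13 h23 h12 hs₃ (by rw [inter_comm]; exact hs₂)
    · -- pairs {1,3} and {3,2}: both through b₃
      exact absorb hb₃ hb₁ hb₂ h13 h23 h12 (by rw [inter_comm]; exact hs₁) hs₃
    · exact hne₃ rfl


/-! ### Packaging: H23, L3 and V5 from three small statements -/

/-- **H23 from three residual statements**, one per shape of the three-side below: (S) below a sunflower and at most one new meet ⟹ at
least five new joins; (C) below a co-sunflower and at most one new meet ⟹ at least three new joins; (F) below neither with five labels, and no new meet ⟹
at least three new joins.  (Complete atom census, memo §9.1: all three hold for every ground set.) [this work] -/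
theorem h23_of
    (hS : ∀ (P : Finset (Finset α)) (r : α) (K : Finset α), IsAntichain (· ⊆ ·) (P : Set (Finset α)) → #(above P r) = 2 →
      #(below P r) = 3 → (∀ b ∈ below P r, ∀ b' ∈ below P r, b ≠ b' → b ∩ b' = K) → #(newMeets P r) ≤ 1 → 5 ≤ #(newJoins P r))
    (hC : ∀ (P : Finset (Finset α)) (r : α) (U : Finset α), IsAntichain (· ⊆ ·) (P : Set (Finset α)) → #(above P r) = 2 →
      #(below P r) = 3 → (∀ b ∈ below P r, ∀ b' ∈ below P r, b ≠ b' → b ∪ b' = U) → #(newMeets P r) ≤ 1 → 3 ≤ #(newJoins P r))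
    (hF : ∀ (P : Finset (Finset α)) (r : α), IsAntichain (· ⊆ ·) (P : Set (Finset α)) → #(above P r) = 2 → #(below P r) = 3 →
      (¬ ∃ K, ∀ b ∈ below P r, ∀ b' ∈ below P r, b ≠ b' → b ∩ b' = K) →
      (¬ ∃ U, ∀ b ∈ below P r, ∀ b' ∈ below P r, b ≠ b' → b ∪ b' = U) →
      #(meets (below P r)) + #(joins (below P r)) ≤ 5 → newMeets P r = ∅ → 3 ≤ #(newJoins P r)) :
    ∀ (P : Finset (Finset α)) (r : α), IsAntichain (· ⊆ ·) (P : Set (Finset α)) → #(above P r) = 2 → #(below P r) = 3 →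
      8 ≤ #(meets (below P r)) + #(joins (below P r)) + newLabels P r := by
  intro P r hanti h2 h3
  have hantiB := isAntichain_below hanti r
  have vB := two_mul_card_le_of_card_le_three (below P r) hantiB (by omega)
  have hA : (above P r).Nonempty := card_pos.1 (by omega)
  have hB : (below P r).Nonempty := card_pos.1 (by omega)
  have c2 := two_le_newLabels_of_min_le_two hanti hA hB (Or.inl (by omega))
  have low : #(newJoins P r) ≤ 1 → 4 ≤ newLabels P r := fun h => four_le_newLabels_of_two_three_newJoins_le_one hanti h2 h3 h
  unfold newLabels at low c2 ⊢
  by_cases hy1 : #(newJoins P r) ≤ 1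
  · have := low hy1; omega
  by_cases hsun : ∃ K, ∀ b ∈ below P r, ∀ b' ∈ below P r, b ≠ b' → b ∩ b' = K
  · -- sunflower below: `f(below) ≥ 4`; need four new labels
    obtain ⟨K, hK⟩ := hsun
    by_cases hx : #(newMeets P r) ≤ 1
    · have := hS P r K hanti h2 h3 hK hx; omega
    · omega
  by_cases hco : ∃ U, ∀ b ∈ below P r, ∀ b' ∈ below P r, b ≠ b' → b ∪ b' = U
  · obtain ⟨U, hU⟩ := hco
    obtain ⟨a, ha⟩ := hA
    obtain ⟨b, hb, hZ⟩ := exists_newMeet_of_cothree hanti h3 hU ha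
    have hm : 1 ≤ #(newMeets P r) := card_pos.2 ⟨_, hZ⟩
    by_cases hx : #(newMeets P r) ≤ 1
    · have := hC P r U hanti h2 h3 hU hx; omega
    · omega
  · -- neither: `f(below) ≥ 5`, need three new labels
    rcases three_members_trichotomy hantiB h3 with hK | hU | h5
    · exact absurd hK hsun
    · exact absurd hU hco
    · by_cases hf6 : 6 ≤ #(meets (below P r)) + #(joins (below P r))
      · omega
      by_cases hm : newMeets P r = ∅
      · have := hF P r hanti h2 h3 hsun hco (by omega) hm
        rw [hm, card_empty]; omega
      · have : 1 ≤ #(newMeets P r) := card_pos.2 (nonempty_iff_ne_empty.2 hm)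
        omega

/-- **L3 from the three residual statements.** [this work] -/
theorem ten_le_of_SCF
    (hS : ∀ (P : Finset (Finset α)) (r : α) (K : Finset α), IsAntichain (· ⊆ ·) (P : Set (Finset α)) → #(above P r) = 2 →
      #(below P r) = 3 → (∀ b ∈ below P r, ∀ b' ∈ below P r, b ≠ b' → b ∩ b' = K) → #(newMeets P r) ≤ 1 → 5 ≤ #(newJoins P r))
    (hC : ∀ (P : Finset (Finset α)) (r : α) (U : Finset α), IsAntichain (· ⊆ ·) (P : Set (Finset α)) → #(above P r) = 2 →
      #(below P r) = 3 → (∀ b ∈ below P r, ∀ b' ∈ below P r, b ≠ b' → b ∪ b' = U) → #(newMeets P r) ≤ 1 → 3 ≤ #(newJoins P r))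
    (hF : ∀ (P : Finset (Finset α)) (r : α), IsAntichain (· ⊆ ·) (P : Set (Finset α)) → #(above P r) = 2 → #(below P r) = 3 →
      (¬ ∃ K, ∀ b ∈ below P r, ∀ b' ∈ below P r, b ≠ b' → b ∩ b' = K) →
      (¬ ∃ U, ∀ b ∈ below P r, ∀ b' ∈ below P r, b ≠ b' → b ∪ b' = U) →
      #(meets (below P r)) + #(joins (below P r)) ≤ 5 → newMeets P r = ∅ → 3 ≤ #(newJoins P r))
    {P : Finset (Finset α)} (hanti : IsAntichain (· ⊆ ·) (P : Set (Finset α))) (h5 : #P = 5) : 10 ≤ #(meets P) + #(joins P) :=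
  ten_le_of_card_eq_five_of (h23_of hS hC hF) hanti h5

/-- **V5 from the three residual statements and L4.** [this work] -/
theorem two_mul_card_le_of_SCF_L4
    (hS : ∀ (P : Finset (Finset α)) (r : α) (K : Finset α), IsAntichain (· ⊆ ·) (P : Set (Finset α)) → #(above P r) = 2 →
      #(below P r) = 3 → (∀ b ∈ below P r, ∀ b' ∈ below P r, b ≠ b' → b ∩ b' = K) → #(newMeets P r) ≤ 1 → 5 ≤ #(newJoins P r))
    (hC : ∀ (P : Finset (Finset α)) (r : α) (U : Finset α), IsAntichain (· ⊆ ·) (P : Set (Finset α)) → #(above P r) = 2 →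
      #(below P r) = 3 → (∀ b ∈ below P r, ∀ b' ∈ below P r, b ≠ b' → b ∪ b' = U) → #(newMeets P r) ≤ 1 → 3 ≤ #(newJoins P r))
    (hF : ∀ (P : Finset (Finset α)) (r : α), IsAntichain (· ⊆ ·) (P : Set (Finset α)) → #(above P r) = 2 → #(below P r) = 3 →
      (¬ ∃ K, ∀ b ∈ below P r, ∀ b' ∈ below P r, b ≠ b' → b ∩ b' = K) →
      (¬ ∃ U, ∀ b ∈ below P r, ∀ b' ∈ below P r, b ≠ b' → b ∪ b' = U) →
      #(meets (below P r)) + #(joins (below P r)) ≤ 5 → newMeets P r = ∅ → 3 ≤ #(newJoins P r))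
    (hL4 : ∀ (P : Finset (Finset α)) (r : α), IsAntichain (· ⊆ ·) (P : Set (Finset α)) → #(above P r) = 6 →
      (below P r).Nonempty → #(meets (above P r)) + #(joins (above P r)) ≤ 11 → 4 ≤ newLabels P r) :
    ∀ P : Finset (Finset α), IsAntichain (· ⊆ ·) (P : Set (Finset α)) → 2 * #P ≤ #(meets P) + #(joins P) + 2 :=
  two_mul_card_le_of_L3_L4 (fun _ hQ h5 => ten_le_of_SCF hS hC hF hQ h5) hL4


/-! ### L3 unconditionally; V5 from L4 alone -/

/-- **H23 (unconditional)**: at every `2 + 3` point of an antichain, `f(below) + newLabels ≥ 8`. [this work] -/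
theorem eight_le_of_two_three (P : Finset (Finset α)) (r : α) (hanti : IsAntichain (· ⊆ ·) (P : Set (Finset α)))
    (h2 : #(above P r) = 2) (h3 : #(below P r) = 3) :
    8 ≤ #(meets (below P r)) + #(joins (below P r)) + newLabels P r :=
  h23_of (fun _ _ _ hanti' h2' h3' hK hx => five_le_card_newJoins_of_two_sunflower_three hanti' h2' h3' hK hx)
    (fun _ _ _ hanti' h2' h3' hU hx => three_le_card_newJoins_of_two_cosunflower_three hanti' h2' h3' hU hx)
    (fun _ _ hanti' h2' h3' hS hC hf h0 => three_le_card_newJoins_of_two_three_five hanti' h2' h3' hS hC hf h0) P r hanti h2 h3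

/-- **L3 (unconditional): every five-member antichain has at least ten labels** (`#meets + #joins ≥ 10`; sharp: the `C([4],2)` blow-ups
minus a member). [this work] -/
theorem ten_le_of_card_eq_five {P : Finset (Finset α)} (hanti : IsAntichain (· ⊆ ·) (P : Set (Finset α))) (h5 : #P = 5) :
    10 ≤ #(meets P) + #(joins P) :=
  ten_le_of_card_eq_five_of eight_le_of_two_three hanti h5

/-- **`AntichainSmallSide` from L4 alone** (weak form `f ≤ 11 → newLabels ≥ 2`). [this work] -/
theorem antichainSmallSide_of_L4
    (hL4 : ∀ (P : Finset (Finset α)) (r : α), IsAntichain (· ⊆ ·) (P : Set (Finset α)) → #(above P r) = 6 →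
      (below P r).Nonempty → #(meets (above P r)) + #(joins (above P r)) ≤ 11 → 2 ≤ newLabels P r) :
    AntichainSmallSide α :=
  antichainSmallSide_of (fun _ hQ h5 => ten_le_of_card_eq_five hQ h5) hL4

/-- **V5 from L4 alone**: if every six-member side with at most eleven labels of its own creates at least four new labels, then every
antichain satisfies `2 #P ≤ #meets P + #joins P + 2`. [this work] -/
theorem two_mul_card_le_of_L4
    (hL4 : ∀ (P : Finset (Finset α)) (r : α), IsAntichain (· ⊆ ·) (P : Set (Finset α)) → #(above P r) = 6 →
      (below P r).Nonempty → #(meets (above P r)) + #(joins (above P r)) ≤ 11 → 4 ≤ newLabels P r) :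
    ∀ P : Finset (Finset α), IsAntichain (· ⊆ ·) (P : Set (Finset α)) → 2 * #P ≤ #(meets P) + #(joins P) + 2 :=
  two_mul_card_le_of_L3_L4 (fun _ hQ h5 => ten_le_of_card_eq_five hQ h5) hL4

/-- **The linear form from L4 alone**: `7 ≤ #P → 2 #P ≤ #meets P + #joins P`. [this work] -/
theorem two_mul_card_le_linear_of_L4
    (hL4 : ∀ (P : Finset (Finset α)) (r : α), IsAntichain (· ⊆ ·) (P : Set (Finset α)) → #(above P r) = 6 →
      (below P r).Nonempty → #(meets (above P r)) + #(joins (above P r)) ≤ 11 → 4 ≤ newLabels P r) :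
    ∀ P : Finset (Finset α), IsAntichain (· ⊆ ·) (P : Set (Finset α)) → 7 ≤ #P → 2 * #P ≤ #(meets P) + #(joins P) :=
  two_mul_card_le_linear_of_L3_L4 (fun _ hQ h5 => ten_le_of_card_eq_five hQ h5) hL4

/-- **V1 from L4 alone.** [this work] -/
theorem card_le_or_card_le_of_L4
    (hL4 : ∀ (P : Finset (Finset α)) (r : α), IsAntichain (· ⊆ ·) (P : Set (Finset α)) → #(above P r) = 6 →
      (below P r).Nonempty → #(meets (above P r)) + #(joins (above P r)) ≤ 11 → 4 ≤ newLabels P r)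
    (P : Finset (Finset α)) (hanti : IsAntichain (· ⊆ ·) (P : Set (Finset α))) : #P ≤ #(meets P) + 1 ∨ #P ≤ #(joins P) + 1 :=
  card_le_or_card_le_of_L3_L4 (fun _ hQ h5 => ten_le_of_card_eq_five hQ h5) hL4 P hanti

/-- **The mid range from L4 alone.** [this work] -/
theorem antichainMidRange_of_L4
    (hL4 : ∀ (P : Finset (Finset α)) (r : α), IsAntichain (· ⊆ ·) (P : Set (Finset α)) → #(above P r) = 6 →
      (below P r).Nonempty → #(meets (above P r)) + #(joins (above P r)) ≤ 11 → 4 ≤ newLabels P r) :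
    AntichainMidRange α :=
  antichainMidRange_of_L3_L4 (fun _ hQ h5 => ten_le_of_card_eq_five hQ h5) hL4 (sixSide_below_of_above' hL4)

end TwoThree

end Summit.CriticalPhenomena.PercolationContinuityZ3.Theorems.SahiColouredDaykin
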